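import Summits.HubbardSuperconductivity.HubbardSuperconductivity.Theorems.AnisotropyChordDressHalfFilledSecondOrderLowerPlaquette
import Literature.MathematicalPhysics.QuantumLattice.SectorGroundProjContinuity
import Literature.MathematicalPhysics.QuantumLattice.FinDimSpectrumProofs
import Literature.MathematicalPhysics.QuantumLattice.SpinChainsLiebMattisProofs
import HarnessLib

/-!
# Crux `DressHalfFilled` (stmt-HubbardSuperconductivity-8148, routes `AnisotropyChord` / `LevyLogBootstrap`), stub 3
# `stub_dressHalfFilled`: the second-order lower bound on the plaquette torus WITH THE GAP DISCHARGED

Helper file (`--supports stmt-HubbardSuperconductivity-8148`), closing the three volume-dependent hypotheses of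
`…SecondOrderLowerPlaquette.plaquette_sectorEnergy_ge_second_order` by finite-dimensional existence statements:

* the GAP `g > 0` of `H_in − E₀(N_b)` on the sector orthogonally to the plaquette ground space — from
  `exists_gap_above_groundMultiplet` (the next eigenvalue of `H_in` restricted to the invariant sector lies strictly above the
  sector energy) and `eigenProj` fixing the `E₀`-eigenvectors;
* the FORM BOUND `|Re⟨v, T v⟩| ≤ τ‖v‖²` — `abs_re_form_le_groundEnergy`, with `τ = max |e₀(T)| |e₀(−T)|` from
  `Matrix.posSemidef_sub_groundEnergy`;
* a UNIT VECTOR in the electron sector `(L² − 2N_b, 0)` — the dressed basis state `Φ |σ⟩` of a spin configuration with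
  `M² − N_b` down spins (`exists_unit_mem_szSector_dictionary`).

Result `plaquette_sectorEnergy_ge_second_order_exists`: for `M ≥ 3`, `PlaquetteData U` and the `k` of clause (d), for every
`N_b ≤ M²` THERE ARE `g > 0` and `τ ≥ 0` such that for every `κ ≥ 0` bounding `−Re⟨φ, (2J·XXZ(Δ_eff) + k(N_b))φ⟩ ≤ κ‖φ‖²` on the
boson sector and all `0 ≤ t'` with `t'τ < g`: **`E₀(N_b) − t'²κ/(1 − t'τ/g) ≤ E_{(L²−2N_b,0)}(H_in + t' T)`**. With
`…SecondOrderUpperXXZ` this is the fixed-`L` second-order asymptotics `E = E₀ + t'²·inf spec(2J·XXZ(Δ_eff) + k) + O_L(t'³)` of the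
effective plaquette-boson gas (when that infimum is `≤ 0`).

HONEST LABEL: `g` and `τ` are pure existence constants at fixed `L` (no uniformity); energies only, no ground states, no order;
the content of stub 3 is untouched; no crux and no summit statement is proved. Sources: T. Kato (1966) II-§2.3 [Kato1966];
W.-F. Tsai, S. A. Kivelson, PRB 73 (2006) 214510, App. A [TsaiKivelson2006]; H. Tasaki (2020) §2.1–§2.4. No definition and no
named fact is introduced; sorry-free.
-/

noncomputable section

-- `dupNamespace`: the summit and the problem are both named `HubbardSuperconductivity` (layout D-0022)
set_option linter.dupNamespace false

namespace Summit.HubbardSuperconductivity.HubbardSuperconductivity.Theorems.AnisotropyChord.DressSecond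

open Matrix Literature.MathematicalPhysics.QuantumLattice Literature.Probability.LatticeModels
open Literature.MathematicalPhysics.QuantumLattice.TorusPlaquette
open Summit.HubbardSuperconductivity.HubbardSuperconductivity.Theorems.LevyLogBootstrap (PlaquetteData dictionary_exhaustion)
open scoped ComplexOrder

/-! ### A form bound for any Hermitian matrix -/

section Form

variable {m : Type*} [Fintype m] [DecidableEq m]

/-- `e₀(X)·‖v‖² ≤ Re⟨v, X v⟩` for Hermitian `X` and every `v` (`X − e₀(X) ≥ 0`). Tasaki (2020) §2.1. [folklore] -/
theorem groundEnergy_mul_le_re_form {X : Matrix m m ℂ} (hX : X.IsHermitian) (v : m → ℂ) :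
    X.groundEnergy * (star v ⬝ᵥ v).re ≤ (star v ⬝ᵥ (X *ᵥ v)).re := by
  have h := (Matrix.posSemidef_sub_groundEnergy hX).dotProduct_mulVec_nonneg v
  rw [sub_mulVec, dotProduct_sub, IsScalarTower.algebraMap_apply ℝ ℂ (Matrix m m ℂ), Algebra.algebraMap_eq_smul_one,
    smul_mulVec, one_mulVec, dotProduct_smul, smul_eq_mul] at h
  obtain ⟨hre, -⟩ := Complex.nonneg_iff.mp h
  rw [Complex.sub_re] at hre
  have e : ((algebraMap ℝ ℂ X.groundEnergy) * (star v ⬝ᵥ v)).re = X.groundEnergy * (star v ⬝ᵥ v).re :=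
    Complex.re_ofReal_mul _ _
  linarith

/-- **Form bound**: `|Re⟨v, X v⟩| ≤ τ(X)·‖v‖²` with `τ(X) = max |e₀(X)| |e₀(−X)|` for Hermitian `X`. [folklore] -/
theorem abs_re_form_le_groundEnergy {X : Matrix m m ℂ} (hX : X.IsHermitian) (v : m → ℂ) :
    |(star v ⬝ᵥ (X *ᵥ v)).re| ≤ max |X.groundEnergy| |(-X).groundEnergy| * (star v ⬝ᵥ v).re := by
  have hn : 0 ≤ (star v ⬝ᵥ v).re := (Complex.nonneg_iff.mp (dotProduct_star_self_nonneg v)).1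
  have h1 := groundEnergy_mul_le_re_form hX v
  have h2 := groundEnergy_mul_le_re_form hX.neg v
  rw [neg_mulVec, dotProduct_neg, Complex.neg_re] at h2
  have ha : -|X.groundEnergy| ≤ X.groundEnergy := neg_abs_le _
  have hb : -|(-X).groundEnergy| ≤ (-X).groundEnergy := neg_abs_le _
  have hma : |X.groundEnergy| ≤ max |X.groundEnergy| |(-X).groundEnergy| := le_max_left _ _
  have hmb : |(-X).groundEnergy| ≤ max |X.groundEnergy| |(-X).groundEnergy| := le_max_right _ _
  rw [abs_le]
  constructor <;> nlinarith [mul_le_mul_of_nonneg_right ha hn, mul_le_mul_of_nonneg_right hb hn,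
    mul_le_mul_of_nonneg_right hma hn, mul_le_mul_of_nonneg_right hmb hn]

end Form

/-! ### A unit vector in every electron sector reached by the dictionary -/

section Unit

variable {M : ℕ} [NeZero M]

/-- A spin configuration with a prescribed number `M² − N_b` of down spins has magnetisation `N_b − M²/2`. [folklore] -/
theorem mag_indicator (A : Finset (TorusSite 2 M)) :
    mag 1 (fun x : TorusSite 2 M => if x ∈ A then (1 : Fin 2) else 0) = (M : ℝ) ^ 2 / 2 - A.card := by
  unfold mag
  have h1 : ∀ x : TorusSite 2 M,
      ((((if x ∈ A then (1 : Fin 2) else 0) : Fin 2) : ℕ) : ℝ) = if x ∈ A then 1 else 0 := by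
    intro x; split_ifs <;> simp
  simp_rw [h1]
  rw [Finset.sum_sub_distrib, Finset.sum_const, Finset.card_univ, card_torusSite_two, Finset.sum_boole,
    Finset.filter_mem_eq_inter, Finset.univ_inter]
  push_cast
  ring

/-- For `N_b ≤ M²` the electron sector `((2M)² − 2N_b, 0)` of the `2M × 2M` torus carries a unit vector — the dictionary
image of a spin basis configuration with `M² − N_b` down spins. [folklore] -/
theorem exists_unit_mem_szSector_dictionary (U : ℝ) {Nb : ℕ} (hNb : Nb ≤ M ^ 2) :
    ∃ v : Fock (Orb (FermionTorus 2 (2 * M))),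
      v ∈ szSector (Λ := FermionTorus 2 (2 * M)) ((2 * M) ^ 2 - 2 * Nb) 0 ∧ star v ⬝ᵥ v = 1 := by
  obtain ⟨A, -, hA⟩ := Finset.exists_subset_card_eq (s := (Finset.univ : Finset (TorusSite 2 M))) (n := M ^ 2 - Nb)
    (by rw [Finset.card_univ, card_torusSite_two]; omega)
  set σ : TensorIndex (TorusSite 2 M) 2 := fun x => if x ∈ A then (1 : Fin 2) else 0 with hσ
  have hmag : mag 1 σ = (Nb : ℝ) - (M : ℝ) ^ 2 / 2 := by
    rw [hσ, mag_indicator, hA, Nat.cast_sub hNb]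
    push_cast
    ring
  have hφ : (Pi.single σ (1 : ℂ) : TensorIndex (TorusSite 2 M) 2 → ℂ) ∈
      spinZSector (Λ := TorusSite 2 M) 1 ((Nb : ℝ) - (M : ℝ) ^ 2 / 2) := by
    rw [← hmag]; exact single_mem_spinZSector 1 σ
  refine ⟨dictionaryMap M U *ᵥ Pi.single σ 1, dictionaryMap_mulVec_mem_szSector U hNb hφ, ?_⟩
  rw [star_mulVec, ← dotProduct_mulVec, mulVec_mulVec, dictionaryMap_conjTranspose_mul_self, one_mulVec,
    dotProduct_single, Pi.star_apply, Pi.single_eq_same, star_one, one_mul]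

end Unit

/-! ### The lower bound with existence constants -/

section Plaquette

variable {M : ℕ} [NeZero M]

set_option linter.style.longLine false in
/-- **Second-order lower bound on the plaquette torus, existence form.** `M ≥ 3`, `PlaquetteData U`. With the `k` of
clause (d): for every `N_b ≤ M²` there are `g > 0` (the gap of `H_in` above `E₀(N_b)` in the sector, orthogonally to the
plaquette ground space) and `τ ≥ 0` (a form bound of `T` ) such that for every `κ ≥ 0` with
`−Re⟨φ, (2J·XXZ(Δ_eff) + k(N_b)·1)φ⟩ ≤ κ‖φ‖²` on the boson sector `S^z_tot = N_b − M²/2` and all `0 ≤ t'`, `t'τ < g`: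
`E₀(N_b) − t'²κ/(1 − t'τ/g) ≤ E_{(L²−2N_b,0)}(H_in + t' T)`. Kato (1966) II-§2.3; Tsai–Kivelson (2006) App. A. [folklore] -/
theorem plaquette_sectorEnergy_ge_second_order_exists (hM : 3 ≤ M) {U : ℝ} (hPD : PlaquetteData U) :
    ∃ k : ℕ → ℝ, ∀ (Nb : ℕ), Nb ≤ M ^ 2 → ∃ g τ : ℝ, 0 < g ∧ 0 ≤ τ ∧ ∀ κ : ℝ, 0 ≤ κ →
      (∀ φ : TensorIndex (TorusSite 2 M) 2 → ℂ, φ ∈ spinZSector (Λ := TorusSite 2 M) 1 ((Nb : ℝ) - (M : ℝ) ^ 2 / 2) →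
        -(star φ ⬝ᵥ ((((2 * (plaquettePairCouplings U).J : ℝ) : ℂ) •
            xxzHamiltonian 1 (torusGraph 2 M) (-1) (plaquettePairCouplings U).ΔEff + ((k Nb : ℝ) : ℂ) • 1) *ᵥ φ)).re ≤
          κ * (star φ ⬝ᵥ φ).re) →
      ∀ t' : ℝ, 0 ≤ t' → t' * τ < g →
    (((M : ℝ) ^ 2 - Nb) * plaquetteEnergy U 0 + Nb * plaquetteEnergy U 2) - t' ^ 2 * κ / (1 - t' * τ / g) ≤
      (hamiltonian (fermionTorusGraph 2 (2 * M) \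
          SimpleGraph.comap (fun x : FermionTorus 2 (2 * M) => fun i : Fin 2 => ((ofLex x) i : ℕ) / 2) ⊤) 1 U +
        (t' : ℂ) • hamiltonian (fermionTorusGraph 2 (2 * M) ⊓
          SimpleGraph.comap (fun x : FermionTorus 2 (2 * M) => fun i : Fin 2 => ((ofLex x) i : ℕ) / 2) ⊤) 1 0).minEnergyOn
        (szSector (Λ := FermionTorus 2 (2 * M)) ((2 * M) ^ 2 - 2 * Nb) 0) := by
  have hM2 : 2 ≤ M := le_trans (by norm_num) hM
  obtain ⟨k, hk⟩ := plaquette_sectorEnergy_ge_second_order hM hPD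
  obtain ⟨-, -, ⟨-, -, hW3⟩, hW4a, hW4b, hW5a, hW5b⟩ := hPD
  refine ⟨k, fun Nb hNb => ?_⟩
  obtain ⟨hmin, -⟩ := dictionary_exhaustion hM2 U hW3 hW4a hW4b hW5a hW5b hNb
  have hH₀ := (hamiltonian_isHermitian_and_commute_holds (fermionTorusGraph 2 (2 * M) \
    SimpleGraph.comap (fun x : FermionTorus 2 (2 * M) => fun i : Fin 2 => ((ofLex x) i : ℕ) / 2) ⊤) 1 U).1
  have hT := (hamiltonian_isHermitian_and_commute_holds (fermionTorusGraph 2 (2 * M) ⊓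
    SimpleGraph.comap (fun x : FermionTorus 2 (2 * M) => fun i : Fin 2 => ((ofLex x) i : ℕ) / 2) ⊤) 1 0).1
  -- the gap above the ground multiplet of `H_in` in the sector
  obtain ⟨g, hg, hgap⟩ := exists_gap_above_groundMultiplet hH₀
    (szSector (Λ := FermionTorus 2 (2 * M)) ((2 * M) ^ 2 - 2 * Nb) 0)
    (fun v hv => hamiltonian_mulVec_mem_szSector _ 1 U hv)
  rw [hmin] at hgap
  -- the form bound of `T`
  set τ : ℝ := max |(hamiltonian (fermionTorusGraph 2 (2 * M) ⊓
      SimpleGraph.comap (fun x : FermionTorus 2 (2 * M) => fun i : Fin 2 => ((ofLex x) i : ℕ) / 2) ⊤) 1 0).groundEnergy|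
    |(-hamiltonian (fermionTorusGraph 2 (2 * M) ⊓
      SimpleGraph.comap (fun x : FermionTorus 2 (2 * M) => fun i : Fin 2 => ((ofLex x) i : ℕ) / 2) ⊤) 1 0).groundEnergy|
    with hτ
  have hτ0 : 0 ≤ τ := le_trans (abs_nonneg _) (le_max_left _ _)
  refine ⟨g, τ, hg, hτ0, fun κ hκ hform t' ht0 htg => ?_⟩
  refine hk Nb hNb κ g τ hκ hg hform ?_ (fun v _ => abs_re_form_le_groundEnergy hT v)
    (exists_unit_mem_szSector_dictionary U hNb) t' ht0 htg
  -- the gap hypothesis in `eigenProj` form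
  intro v hv hPv
  have h := hgap v hv (fun ψ hψK hψ => ?_)
  · linarith
  · -- an `E₀`-eigenvector is fixed by `P`; so `⟨ψ, v⟩ = ⟨Pψ, v⟩ = ⟨ψ, P v⟩ = 0`
    have hPψ := eigenProj_mulVec_of_eigenvector hH₀ hψ
    rw [← hPψ, star_mulVec, ← dotProduct_mulVec, (eigenProj_isHermitian _ _).eq, hPv, dotProduct_zero]

end Plaquette

end Summit.HubbardSuperconductivity.HubbardSuperconductivity.Theorems.AnisotropyChord.DressSecond

end
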